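import Literature.NumberTheory.PAdicHodge.DeRhamBaseChangeProofs
import HarnessLib

/-!
# Stub `stub_deRhamBaseChange_local` of the crux `ReciprocityTRCM` (line `pieces` = payload line
`registered`, crux item stmt-Langlands-1093, route `BaseFieldAscent`) — PROVED

The registered stub 5L of the skeleton `Cruxes/ReciprocityTRCM/Lines/pieces.lean` is, BY NAME, the
Literature named fact `Literature.NumberTheory.PAdicHodge.DeRhamBaseChange` (Brinon–Conrad 2009,
Prop. 6.3.8, tree form: the de Rham property for THE pinned datum `fontainePst` is insensitive to a
finite extension of the `p`-adic base field).  It is now a THEOREM of the tree,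
`Literature.NumberTheory.PAdicHodge.DeRhamBaseChange_holds` (file
`Literature/NumberTheory/PAdicHodge/DeRhamBaseChangeProofs.lean`, with its infrastructure
`LocalFieldEmbeddingNorm`, `CompletedAlgClosureBaseChange`, `BdRBaseChange`,
`GaloisRepresentations/AdmissibleRestrictOfRingEquiv`), and this file records the stub under its
registered name and signature for the crux ledger (`--supports stmt-Langlands-1093`).

## References
* [BrinonConrad2009] O. Brinon, B. Conrad, *CMI Summer School notes on p-adic Hodge theory*
  (2009), Prop. 6.3.8.
-/

set_option linter.dupNamespace false -- project-wide option; `Summit.Langlands.Langlands` is the mandated namespace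

namespace Summit.Langlands.Langlands.Theorems.ReciprocityTRCM

/-- **STUB 5L of line `pieces` — the de Rham property is insensitive to a finite extension of the
`p`-adic base field, for THE pinned data** (registered signature:
`Literature.NumberTheory.PAdicHodge.DeRhamBaseChange`, verbatim), now unconditional: it is the
accepted discharge `DeRhamBaseChange_holds` (Brinon–Conrad 2009, Prop. 6.3.8; Fontaine 1994,
Exp. III §1.5, §3). [cite: BrinonConrad2009, Prop. 6.3.8] -/
theorem stub_deRhamBaseChange_local : Literature.NumberTheory.PAdicHodge.DeRhamBaseChange :=
  Literature.NumberTheory.PAdicHodge.DeRhamBaseChange_holds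

end Summit.Langlands.Langlands.Theorems.ReciprocityTRCM
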